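import Mathlib
import Summits.ValiantsHypothesis.ValiantsHypothesis.Theorems.BarrierLeverPartitionMinorsHitByVPHiddenStatesCutGame
import Summits.ValiantsHypothesis.ValiantsHypothesis.Theorems.BarrierLeverPartitionMinorsHitByVPSimplexJoinCutBridge
import Summits.ValiantsHypothesis.ValiantsHypothesis.Theorems.BarrierLeverPartitionMinorsHitByVPSimplexJoinNodes

/-!
# Route BarrierLever — item `PartitionMinorsHitByVP` (stmt-ValiantsHypothesis-19717), line `hidden_states`:
# THE BOX-SPLITTING GAME — a one-slot-per-piece splitting strategy for a simplex-product design closes the registered pair stub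

Helper file (`--supports stmt-ValiantsHypothesis-19717`; cell valiant-natproofs, rung V4, 𝒟-side door (c), line
`Cruxes/PartitionMinorsHitByVP/Lines/hidden_states.lean` v8, registered stub `stub_simplexPairLower` ≡ `SimplexJoin.Stmt.simplexPairLower`;
prover seat val-np-p3 gen 13). Definition-free. Closes NO item.

THE POINT (memo val-np-p3 g13 «box-splitting», evidence #51 on 19717). Combine the u-OBLIVIOUS CUT GAME (`SymbJoin.symGood_of_winning`,
p647050) with the simplex bridge (`Cut.simplexGood_iff_symGood`, `Cut.xi_oneSlot`, p646549): a predicate `W hd r e` on SIMPLEX column data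
`e : Fin r → Fin m × (Fin D → Option (Fin N))` WINS THE BOX GAME if every `W`-position with `r ≥ 2` answers every demand `r₀ + r₁ = r`,
`⌊(r−2)/hd⌋ + 1 ≤ r₁ ≤ r₀ ≤ 2^(hd−1)` by choosing, for every piece `p`, ONE slot `f p` and a two-colouring `side p` of that slot's values
(`none` included), such that the columns whose chosen slot carries a `false` value number `r₀`, the others `r₁`, and both colour classes are
`W`-positions with `hd − 1` (`simplexSymGood_of_boxWinning`). No linear algebra, no row family: a statement about multisets of boxes
(each piece = product of its slots' value sets; a move splits one side of every box, either part to either side). CONSEQUENCES: every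
`W`-position with `h` coordinates is good for EVERY injective lower row family (`exists_simplexTable_of_boxWinning`), so ONE winning
budget-legal root design per `(h, r)` gives the registered pair node `Stmt.simplexPairLower` (`simplexPairLower_of_boxWinning`) and the item
(`partitionMinorsHitByVP_of_boxWinning`, `b = 14` through p610840). The lab census of the seat (lab/sim7.py; kit j311880) finds such
strategies for the fat base-`4h` staircase at every tested `h ≤ 64` with zero failures; the ∀h winning invariant is the open arithmetic.

WHAT THIS IS NOT: no winning predicate is constructed here; `Stmt.simplexPairLower` and item 19717 stay OPEN; nothing on crux 14610 or VP ≠ VNP.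
-/

set_option linter.dupNamespace false

namespace Summit.ValiantsHypothesis.ValiantsHypothesis.Theorems.BarrierLever.SimplexJoin.Cut

open Finset Matrix MvPolynomial
open Summit.ValiantsHypothesis.ValiantsHypothesis.Theorems.BarrierLever.HiddenStates

noncomputable section

variable {h m D N : ℕ}

/-- **THE BOX-SPLITTING GAME CERTIFIES.** Let `W hd r e` be a predicate on simplex column data such that every `W`-position with
`r ≥ 2` answers every demand `r₀ + r₁ = r`, `⌊(r−2)/hd⌋ + 1 ≤ r₁ ≤ r₀ ≤ 2^(hd−1)` by one slot `f p` and one colouring `side p` per piece,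
with the `false`-coloured columns enumerated by `g₀` (size `r₀`), the `true`-coloured by `g₁` (size `r₁`), both again `W`-positions with
`hd − 1`. Then every `W`-position is generically good (in the encoded symbolic calculus) against EVERY injective lower row family on
`≤ hd` coordinates. -/
theorem simplexSymGood_of_boxWinning (W : (hd : ℕ) → (r : ℕ) → (Fin r → Fin m × (Fin D → Option (Fin N))) → Prop)
    (hwin : ∀ (hd r : ℕ) (e : Fin r → Fin m × (Fin D → Option (Fin N))), W hd r e → 2 ≤ r → 1 ≤ hd →
      ∀ r₀ r₁ : ℕ, r₀ + r₁ = r → (r - 2) / hd + 1 ≤ r₁ → r₁ ≤ r₀ → r₀ ≤ 2 ^ (hd - 1) →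
        ∃ (f : Fin m → Fin D) (side : Fin m → Option (Fin N) → Bool) (g₀ : Fin r₀ → Fin r) (g₁ : Fin r₁ → Fin r),
          Function.Injective (Sum.elim g₀ g₁) ∧
          (∀ j, side (e (g₀ j)).1 ((e (g₀ j)).2 (f (e (g₀ j)).1)) = false) ∧
          (∀ j, side (e (g₁ j)).1 ((e (g₁ j)).2 (f (e (g₁ j)).1)) = true) ∧
          W (hd - 1) r₀ (fun j => e (g₀ j)) ∧ W (hd - 1) r₁ (fun j => e (g₁ j)))
    (hd r : ℕ) (u : Fin r → Finset (Fin h)) (C : Finset (Fin h)) (e : Fin r → Fin m × (Fin D → Option (Fin N)))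
    (hC : C.card ≤ hd) (hu : Function.Injective u) (hlow : IsLowerSet (Set.range u)) (hsub : ∀ i, u i ⊆ C) (hW : W hd r e) :
    SymbJoin.symDet u (fun k => enc (e k)) ≠ 0 := by
  classical
  -- the induced predicate on wide column data
  let W' : (hd : ℕ) → (r : ℕ) → (Fin r → Fin m × Finset (Fin (D * N))) → Prop :=
    fun hd r e' => ∃ e : Fin r → Fin m × (Fin D → Option (Fin N)), (e' = fun k => enc (e k)) ∧ W hd r e
  have hwin' : ∀ (hd r : ℕ) (e' : Fin r → Fin m × Finset (Fin (D * N))), W' hd r e' → 2 ≤ r → 1 ≤ hd →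
      ∀ r₀ r₁ : ℕ, r₀ + r₁ = r → (r - 2) / hd + 1 ≤ r₁ → r₁ ≤ r₀ → r₀ ≤ 2 ^ (hd - 1) →
        ∃ (β : Fin m → ℂ) (γ : Fin m → Fin (D * N) → ℂ) (g₀ : Fin r₀ → Fin r) (g₁ : Fin r₁ → Fin r),
          Function.Injective (Sum.elim g₀ g₁) ∧ (∀ j, SymbJoin.xi e' β γ (g₀ j) = 0) ∧ (∀ j, SymbJoin.xi e' β γ (g₁ j) ≠ 0) ∧
          W' (hd - 1) r₀ (fun j => e' (g₀ j)) ∧ W' (hd - 1) r₁ (fun j => e' (g₁ j)) := by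
    rintro hd r e' ⟨e, rfl, hWe⟩ hr hhd r₀ r₁ hsum hlam h10 hpow
    obtain ⟨f, side, g₀, g₁, hg, hfalse, htrue, hW0, hW1⟩ := hwin hd r e hWe hr hhd r₀ r₁ hsum hlam h10 hpow
    let ind : Bool → ℂ := fun b => if b then 1 else 0
    let β : Fin m → ℂ := fun p => ind (side p none)
    let γ : Fin m → Fin (D * N) → ℂ := fun p q =>
      if (finProdFinEquiv.symm q).1 = f p then ind (side p (some (finProdFinEquiv.symm q).2)) - ind (side p none) else 0
    have hxi : ∀ k, SymbJoin.xi (fun k => enc (e k)) β γ k = ind (side (e k).1 ((e k).2 (f (e k).1))) := by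
      intro k
      refine xi_oneSlot e β γ k (f (e k).1) (side (e k).1) rfl (fun j => ?_) (fun f' j hf' => ?_)
      · dsimp only [γ]
        rw [Equiv.symm_apply_apply]
        simp [ind]
      · dsimp only [γ]
        rw [Equiv.symm_apply_apply]
        simp [hf']
    refine ⟨β, γ, g₀, g₁, hg, fun j => ?_, fun j => ?_, ⟨fun j => e (g₀ j), rfl, hW0⟩, ⟨fun j => e (g₁ j), rfl, hW1⟩⟩
    · rw [hxi, hfalse j]; simp [ind]
    · rw [hxi, htrue j]; simp [ind]
  exact SymbJoin.symGood_of_winning W' (fun hd r => (r - 2) / hd + 1)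
    (fun hd r u C hCd hu _ hC hr => SymbJoin.exists_link_ge hd u C hCd hu hC hr) hwin'
    hd r u C (fun k => enc (e k)) hC hu hlow hsub ⟨e, rfl, hW⟩

/-- **A box-game winning position is good for every lower row family** (`∃ table` form of the exact-support door). -/
theorem exists_simplexTable_of_boxWinning (W : (hd : ℕ) → (r : ℕ) → (Fin r → Fin m × (Fin D → Option (Fin N))) → Prop)
    (hwin : ∀ (hd r : ℕ) (e : Fin r → Fin m × (Fin D → Option (Fin N))), W hd r e → 2 ≤ r → 1 ≤ hd →
      ∀ r₀ r₁ : ℕ, r₀ + r₁ = r → (r - 2) / hd + 1 ≤ r₁ → r₁ ≤ r₀ → r₀ ≤ 2 ^ (hd - 1) →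
        ∃ (f : Fin m → Fin D) (side : Fin m → Option (Fin N) → Bool) (g₀ : Fin r₀ → Fin r) (g₁ : Fin r₁ → Fin r),
          Function.Injective (Sum.elim g₀ g₁) ∧
          (∀ j, side (e (g₀ j)).1 ((e (g₀ j)).2 (f (e (g₀ j)).1)) = false) ∧
          (∀ j, side (e (g₁ j)).1 ((e (g₁ j)).2 (f (e (g₁ j)).1)) = true) ∧
          W (hd - 1) r₀ (fun j => e (g₀ j)) ∧ W (hd - 1) r₁ (fun j => e (g₁ j)))
    {r : ℕ} (e : Fin r → Fin m × (Fin D → Option (Fin N))) (hW : W h r e)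
    (u : Fin r → Finset (Fin h)) (hu : Function.Injective u) (hlow : IsLowerSet (Set.range u)) :
    ∃ tx : Fin m → Option (Fin D × Fin N) → Fin h → ℂ,
      (Matrix.of fun i k : Fin r => ∏ a ∈ u i,
        (tx (e k).1 none a + ∑ f : Fin D, ((e k).2 f).elim 0 fun j => tx (e k).1 (some (f, j)) a)).det ≠ 0 := by
  refine exists_simplexTable_of_symGood u e ?_
  refine simplexSymGood_of_boxWinning W hwin h r u Finset.univ e ?_ hu hlow (fun i => Finset.subset_univ _) hW
  rw [Finset.card_univ, Fintype.card_fin]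

/-- **ONE WINNING ROOT DESIGN PER `(h, r)` GIVES THE REGISTERED PAIR NODE.** If a box-game winning predicate `W` admits, for all large
`h` and every `r ≤ 2^h`, a budget-legal simplex-product design (`m ≤ (2h)²` pieces, depth `D ≤ 2h`, width `N ≤ (2h)²`, exact live
enumeration) that is a `W`-position with `h` coordinates, then `SimplexJoin.Stmt.simplexPairLower` holds (the same design serves
both lower families of a pair). -/
theorem simplexPairLower_of_boxWinning
    (HW : ∃ h₁ : ℕ, ∀ h : ℕ, h₁ ≤ h → ∀ r : ℕ, r ≤ 2 ^ h →
      ∃ (m D N : ℕ) (S : Fin m → Fin D → Finset (Fin N)) (e : Fin r → Fin m × (Fin D → Option (Fin N)))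
        (W : (hd : ℕ) → (r : ℕ) → (Fin r → Fin m × (Fin D → Option (Fin N))) → Prop),
        m ≤ (h + h) ^ 2 ∧ D ≤ h + h ∧ N ≤ (h + h) ^ 2 ∧ Function.Injective e ∧
        (∀ c : Fin m × (Fin D → Option (Fin N)),
          c ∈ Set.range e ↔ ∀ (f : Fin D) (j : Fin N), c.2 f = some j → j ∈ S c.1 f) ∧
        (∀ (hd r : ℕ) (e : Fin r → Fin m × (Fin D → Option (Fin N))), W hd r e → 2 ≤ r → 1 ≤ hd →
          ∀ r₀ r₁ : ℕ, r₀ + r₁ = r → (r - 2) / hd + 1 ≤ r₁ → r₁ ≤ r₀ → r₀ ≤ 2 ^ (hd - 1) →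
            ∃ (f : Fin m → Fin D) (side : Fin m → Option (Fin N) → Bool) (g₀ : Fin r₀ → Fin r) (g₁ : Fin r₁ → Fin r),
              Function.Injective (Sum.elim g₀ g₁) ∧
              (∀ j, side (e (g₀ j)).1 ((e (g₀ j)).2 (f (e (g₀ j)).1)) = false) ∧
              (∀ j, side (e (g₁ j)).1 ((e (g₁ j)).2 (f (e (g₁ j)).1)) = true) ∧
              W (hd - 1) r₀ (fun j => e (g₀ j)) ∧ W (hd - 1) r₁ (fun j => e (g₁ j))) ∧
        W h r e) :
    Stmt.simplexPairLower := by
  obtain ⟨h₁, HW⟩ := HW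
  refine ⟨h₁, fun h hh r u w hu hw hul hwl => ?_⟩
  have hr : r ≤ 2 ^ h := by
    have := Fintype.card_le_of_injective u hu
    rwa [Fintype.card_fin, Fintype.card_finset, Fintype.card_fin] at this
  obtain ⟨m, D, N, S, e, W, hm, hD, hN, he, hlive, hwin, hWe⟩ := HW h hh r hr
  exact ⟨m, D, N, S, e, hm, hD, hN, he, hlive,
    exists_simplexTable_of_boxWinning W hwin e hWe u hu hul,
    exists_simplexTable_of_boxWinning W hwin e hWe w hw hwl⟩

/-- **…and hence the item** (`b = 14`, through `partitionMinorsHitByVP_of_simplexPairLower`, p610840). -/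
theorem partitionMinorsHitByVP_of_boxWinning
    (HW : ∃ h₁ : ℕ, ∀ h : ℕ, h₁ ≤ h → ∀ r : ℕ, r ≤ 2 ^ h →
      ∃ (m D N : ℕ) (S : Fin m → Fin D → Finset (Fin N)) (e : Fin r → Fin m × (Fin D → Option (Fin N)))
        (W : (hd : ℕ) → (r : ℕ) → (Fin r → Fin m × (Fin D → Option (Fin N))) → Prop),
        m ≤ (h + h) ^ 2 ∧ D ≤ h + h ∧ N ≤ (h + h) ^ 2 ∧ Function.Injective e ∧
        (∀ c : Fin m × (Fin D → Option (Fin N)),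
          c ∈ Set.range e ↔ ∀ (f : Fin D) (j : Fin N), c.2 f = some j → j ∈ S c.1 f) ∧
        (∀ (hd r : ℕ) (e : Fin r → Fin m × (Fin D → Option (Fin N))), W hd r e → 2 ≤ r → 1 ≤ hd →
          ∀ r₀ r₁ : ℕ, r₀ + r₁ = r → (r - 2) / hd + 1 ≤ r₁ → r₁ ≤ r₀ → r₀ ≤ 2 ^ (hd - 1) →
            ∃ (f : Fin m → Fin D) (side : Fin m → Option (Fin N) → Bool) (g₀ : Fin r₀ → Fin r) (g₁ : Fin r₁ → Fin r),
              Function.Injective (Sum.elim g₀ g₁) ∧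
              (∀ j, side (e (g₀ j)).1 ((e (g₀ j)).2 (f (e (g₀ j)).1)) = false) ∧
              (∀ j, side (e (g₁ j)).1 ((e (g₁ j)).2 (f (e (g₁ j)).1)) = true) ∧
              W (hd - 1) r₀ (fun j => e (g₀ j)) ∧ W (hd - 1) r₁ (fun j => e (g₁ j))) ∧
        W h r e) :
    Summit.ValiantsHypothesis.ValiantsHypothesis.Theses.BarrierLever.PartitionMinorsHitByVP :=
  partitionMinorsHitByVP_of_simplexPairLower (simplexPairLower_of_boxWinning HW)

end

end Summit.ValiantsHypothesis.ValiantsHypothesis.Theorems.BarrierLever.SimplexJoin.Cut
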